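import Mathlib
import HarnessLib
import Summits.KontsevichZagierPeriods.Zeta5Search.VWPBarnesFarLine
import Summits.KontsevichZagierPeriods.Zeta5Search.VWPSeriesTerms

/-!
# ζ(5) search — the weighted Barnes integral of `F_m` as a power series, `0 < w < 1` (cell `pub-zeta5`, ct-1 g28)

HONEST FRAMING: systematic search; no irrationality claim unless kernel-certified.  An identity of special functions (Mellin–Barnes
integral = hypergeometric-type power series inside the unit disc); nothing here is an irrationality result, a worthiness exponent or
a denominator statement; no named fact is discharged; no definition is introduced.

Fifth piece of brick B4 of `HOME/ct-1/g27/VWP-BLUEPRINT-g27.md`.  Combining the contour shift `VWPBarnesShift.integral_far_sub_integral_base`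
with the vanishing of the far line `VWPBarnesFarLine.tendsto_integral_far` and the absolute convergence of Zudilin's series
(`VWPSeriesSummable.summable_vwpTerm`), for `0 < w < 1`:

  `(1/2π) ∫ V(s) e^{iεπs} w^s dy |_{s = −s₁+iy} = Σ_μ (h₀+2μ) ∏_{j=0}^{m} Γ(h_j+μ)/Γ(1+h₀−h_j+μ) · (−1)^μ e^{iεπμ} w^μ`
                                                                                           (`barnes_weighted_eq_tsum`)

under `0 < s₁ < Re h_j` (`j ≤ m`), `s₁ < Re(1+h₀−h_{j+1})` (`j < m`), Zudilin's (5) and `|ε| ≤ 1` — the Barnes-integral representation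
of the very-well-poised series with the Abel weight `w^μ` [Nesterenko 2003, Lemma 3; Zudilin math/0206177, §2; the device of
Whittaker–Watson §14.5].  The boundary value `w → 1⁻` is taken in `VWPBarnesSeries`.

* `norm_phase_nat`, `summable_weighted` — the weighted terms are dominated by the terms of `F_m`;
* **`barnes_weighted_eq_tsum`**.

Theorems only; imports `Zeta5Search/VWPBarnesFarLine`, `Zeta5Search/VWPSeriesTerms`.
-/

noncomputable section

namespace Summit.KontsevichZagierPeriods.Zeta5Search.VWPBarnesWeighted

open MeasureTheory Set Filter
open scoped Real Topology
open Summit.KontsevichZagierPeriods.Zeta5Search.VWPBarnesShift (integral_far_sub_integral_base norm_weight_eq)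
open Summit.KontsevichZagierPeriods.Zeta5Search.VWPBarnesFarLine (tendsto_integral_far)
open Summit.KontsevichZagierPeriods.Zeta5Search.VWPSeriesSummable (summable_vwpTerm)
open Summit.KontsevichZagierPeriods.Zeta5Search.VWPSeriesTerms (term_eq_regularPart)

variable {m : ℕ} {h : ℕ → ℂ} {s₁ ε w : ℝ}

/-! ### 1. The weighted terms are dominated by the terms of `F_m` -/

/-- `‖e^{iεπn}‖ = 1` for a natural number `n`. -/
theorem norm_phase_nat (ε : ℝ) (n : ℕ) : ‖Complex.exp (ε * π * Complex.I * n)‖ = 1 := by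
  rw [Complex.norm_exp]
  simp [Complex.mul_re, Complex.mul_im]

/-- From `s₁ < Re(1+h₀−h_{j+1})` (`j < m`) and `s₁ > 0`: `0 < Re(1+h₀−h_j)` for all `j ≤ m` (the case `j = 0` is `Re 1 = 1`). -/
theorem den_pos_all (m : ℕ) (h : ℕ → ℂ) (hs₁ : 0 < s₁) (hden : ∀ j, j < m → s₁ < (1 + h 0 - h (j + 1)).re) :
    ∀ j, j ≤ m → 0 < (1 + h 0 - h j).re := by
  intro j hj
  rcases j with _ | j
  · simp
  · exact lt_trans hs₁ (hden j (by omega))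

/-- **Domination of the weighted terms**: for `0 ≤ w ≤ 1` the terms
`[(h₀+2n)∏_{j≤m}Γ(h_j+n)/∏_{j<m}Γ(1+h₀−h_{j+1}+n)/n!] (−1)^n e^{iεπn} w^n` have norm at most that of the `F_m` term, hence are summable
under (5). -/
theorem summable_weighted (m : ℕ) (h : ℕ → ℂ) (hpos : ∀ j, j ≤ m → 0 < (h j).re) (hden : ∀ j, j ≤ m → 0 < (1 + h 0 - h j).re)
    (h5 : 2 * (∑ j ∈ Finset.range m, (h (j + 1)).re) < ((m : ℝ) - 1) * (1 + (h 0).re)) (ε : ℝ) (hw0 : 0 ≤ w) (hw1 : w ≤ 1) :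
    Summable fun n : ℕ =>
      ((h 0 + 2 * (n : ℂ)) * (∏ j ∈ Finset.range (m + 1), Complex.Gamma (h j + n)) /
            (∏ j ∈ Finset.range m, Complex.Gamma (1 + h 0 - h (j + 1) + n)) / (n.factorial : ℂ)) *
          (-1 : ℂ) ^ n * Complex.exp (ε * π * Complex.I * n) * (w : ℂ) ^ n := by
  refine Summable.of_norm_bounded (summable_vwpTerm m h hpos hden h5).norm fun n => ?_
  rw [← term_eq_regularPart m h n]
  set C : ℂ := (h 0 + 2 * (n : ℂ)) *
    ∏ j ∈ Finset.range (m + 1), Complex.Gamma (h j + n) / Complex.Gamma (1 + h 0 - h j + n) with hC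
  clear_value C
  have h1 : ‖(-1 : ℂ) ^ n‖ = 1 := by rw [norm_pow, norm_neg, norm_one, one_pow]
  have h2 : ‖(-1 : ℂ) ^ ((m + 1) * n)‖ = 1 := by rw [norm_pow, norm_neg, norm_one, one_pow]
  have h3 : ‖(w : ℂ) ^ n‖ = w ^ n := by rw [norm_pow, Complex.norm_real, Real.norm_eq_abs, abs_of_nonneg hw0]
  calc ‖C * (-1 : ℂ) ^ n * Complex.exp (ε * π * Complex.I * n) * (w : ℂ) ^ n‖ = ‖C‖ * w ^ n := by
        rw [norm_mul, norm_mul, norm_mul, norm_phase_nat, h1, h3]; ring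
    _ ≤ ‖C‖ := mul_le_of_le_one_right (norm_nonneg _) (pow_le_one₀ hw0 hw1)
    _ = ‖C * (-1 : ℂ) ^ ((m + 1) * n)‖ := by rw [norm_mul, h2, mul_one]

/-! ### 2. The weighted Barnes integral as a power series -/

/-- **The Barnes integral of `F_m` with the Abel weight** [Nesterenko 2003, Lemma 3; Zudilin math/0206177, §2]: for `h : ℕ → ℂ`,
`0 < s₁ < Re h_j` (`j ≤ m`), `s₁ < Re(1+h₀−h_{j+1})` (`j < m`), `2 Σ_{j=1}^m Re h_j < (m−1)(1 + Re h₀)` (5), `|ε| ≤ 1` and `0 < w < 1`: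
`(1/2π) ∫ V(−s₁+iy) e^{iεπ(−s₁+iy)} w^{−s₁+iy} dy = Σ_μ (h₀+2μ) ∏_{j≤m} Γ(h_j+μ)/Γ(1+h₀−h_j+μ) · (−1)^μ e^{iεπμ} w^μ`. -/
theorem barnes_weighted_eq_tsum (m : ℕ) (h : ℕ → ℂ) (hs₁ : 0 < s₁) (hnum : ∀ j, j ≤ m → s₁ < (h j).re)
    (hden : ∀ j, j < m → s₁ < (1 + h 0 - h (j + 1)).re)
    (h5 : 2 * (∑ j ∈ Finset.range m, (h (j + 1)).re) < ((m : ℝ) - 1) * (1 + (h 0).re))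
    (hε : |ε| ≤ 1) (hw : 0 < w) (hw1 : w < 1) :
    (1 / (2 * π) : ℂ) * ∫ y : ℝ,
        (h 0 + 2 * (-(s₁ : ℂ) + (y : ℂ) * Complex.I)) *
                (∏ j ∈ Finset.range (m + 1), Complex.Gamma (h j + (-(s₁ : ℂ) + (y : ℂ) * Complex.I))) *
                Complex.Gamma (-(-(s₁ : ℂ) + (y : ℂ) * Complex.I)) /
              (∏ j ∈ Finset.range m, Complex.Gamma (1 + h 0 - h (j + 1) + (-(s₁ : ℂ) + (y : ℂ) * Complex.I))) *
            Complex.exp (ε * π * Complex.I * (-(s₁ : ℂ) + (y : ℂ) * Complex.I)) *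
          (w : ℂ) ^ (-(s₁ : ℂ) + (y : ℂ) * Complex.I) =
      ∑' μ : ℕ, (h 0 + 2 * (μ : ℂ)) *
          (∏ j ∈ Finset.range (m + 1), Complex.Gamma (h j + μ) / Complex.Gamma (1 + h 0 - h j + μ)) *
        ((-1 : ℂ) ^ μ * Complex.exp (ε * π * Complex.I * μ) * (w : ℂ) ^ μ) := by
  have hpos : ∀ j, j ≤ m → 0 < (h j).re := fun j hj => lt_trans hs₁ (hnum j hj)
  have hden0 : ∀ j, j < m → 0 < (1 + h 0 - h (j + 1)).re := fun j hj => lt_trans hs₁ (hden j hj)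
  have hden' := den_pos_all m h hs₁ hden
  -- the three players
  set base : ℂ := ∫ y : ℝ,
        (h 0 + 2 * (-(s₁ : ℂ) + (y : ℂ) * Complex.I)) *
                (∏ j ∈ Finset.range (m + 1), Complex.Gamma (h j + (-(s₁ : ℂ) + (y : ℂ) * Complex.I))) *
                Complex.Gamma (-(-(s₁ : ℂ) + (y : ℂ) * Complex.I)) /
              (∏ j ∈ Finset.range m, Complex.Gamma (1 + h 0 - h (j + 1) + (-(s₁ : ℂ) + (y : ℂ) * Complex.I))) *
            Complex.exp (ε * π * Complex.I * (-(s₁ : ℂ) + (y : ℂ) * Complex.I)) *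
          (w : ℂ) ^ (-(s₁ : ℂ) + (y : ℂ) * Complex.I) with hbase
  set far : ℕ → ℂ := fun N => ∫ y : ℝ,
        (h 0 + 2 * ((((N : ℝ) + 1 / 2 : ℝ) : ℂ) + (y : ℂ) * Complex.I)) *
                (∏ j ∈ Finset.range (m + 1), Complex.Gamma (h j + ((((N : ℝ) + 1 / 2 : ℝ) : ℂ) + (y : ℂ) * Complex.I))) *
                Complex.Gamma (-((((N : ℝ) + 1 / 2 : ℝ) : ℂ) + (y : ℂ) * Complex.I)) /
              (∏ j ∈ Finset.range m,
                Complex.Gamma (1 + h 0 - h (j + 1) + ((((N : ℝ) + 1 / 2 : ℝ) : ℂ) + (y : ℂ) * Complex.I))) *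
            Complex.exp (ε * π * Complex.I * ((((N : ℝ) + 1 / 2 : ℝ) : ℂ) + (y : ℂ) * Complex.I)) *
          (w : ℂ) ^ ((((N : ℝ) + 1 / 2 : ℝ) : ℂ) + (y : ℂ) * Complex.I) with hfar
  set t : ℕ → ℂ := fun n =>
      ((h 0 + 2 * (n : ℂ)) * (∏ j ∈ Finset.range (m + 1), Complex.Gamma (h j + n)) /
            (∏ j ∈ Finset.range m, Complex.Gamma (1 + h 0 - h (j + 1) + n)) / (n.factorial : ℂ)) *
          (-1 : ℂ) ^ n * Complex.exp (ε * π * Complex.I * n) * (w : ℂ) ^ n with ht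
  have hshift : ∀ N : ℕ, far N - base = -(2 * π * ∑ n ∈ Finset.range (N + 1), t n) := fun N =>
    integral_far_sub_integral_base m h hs₁ hnum hden h5 hε hw N
  have hfar0 : Tendsto far atTop (𝓝 0) := tendsto_integral_far m h hpos hden0 h5 hε hw hw1
  have hsum : Summable t := summable_weighted m h hpos hden' h5 ε hw.le hw1.le
  have hS : Tendsto (fun N : ℕ => ∑ n ∈ Finset.range (N + 1), t n) atTop (𝓝 (∑' n, t n)) :=
    hsum.hasSum.tendsto_sum_nat.comp (tendsto_add_atTop_nat 1)
  have hlim : Tendsto (fun N : ℕ => far N + 2 * π * ∑ n ∈ Finset.range (N + 1), t n) atTop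
      (𝓝 (0 + 2 * π * ∑' n, t n)) := hfar0.add (hS.const_mul _)
  have hconst : (fun N : ℕ => far N + 2 * π * ∑ n ∈ Finset.range (N + 1), t n) = fun _ => base := by
    funext N
    have := hshift N
    linear_combination this
  rw [hconst, zero_add] at hlim
  have hbase_eq : base = 2 * π * ∑' n, t n := tendsto_nhds_unique tendsto_const_nhds hlim
  rw [hbase_eq, ← mul_assoc]
  have hπ : (π : ℂ) ≠ 0 := by exact_mod_cast Real.pi_pos.ne'
  rw [show (1 / (2 * π) : ℂ) * (2 * π) = 1 by field_simp, one_mul]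
  refine tsum_congr fun n => ?_
  simp only [ht]
  rw [term_eq_regularPart m h n]
  ring

end Summit.KontsevichZagierPeriods.Zeta5Search.VWPBarnesWeighted

end
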